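import Literature.AlgebraicGeometry.Surfaces.LatticePolarizedK3Fibration
import Literature.AlgebraicGeometry.Motives.LocalSystemParabolicCohomology
import HarnessLib

/-!
# `H¹(B, j_*𝒯) ↪ H³(Y)` for a threefold fibred by lattice-polarised K3 surfaces
# (Doran–Harder–Novoseltsev–Thompson 2019, Lemma 2.5 and eq. (2.4); Zucker 1979;
# del Angel–Müller-Stach–van Straten–Zuo 2010, §0 and Prop. 7)

Family `hodge`, layer `Literature/AlgebraicGeometry/Surfaces`; the Hodge-theoretic named facts
of definition request `defn-LatticePolarizedK3Fibration` (route `HodgeConjecture/SecondaryPeriods`,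
D1: "the named fact `H¹(B, j_*𝒯) ↪ H³(Y)` with level-one cokernel (DHNT2019 Lemma 2.5)", used as
"`H³(Y) = H¹(ℙ¹, j_*𝒯)` when `b₃(Y) = h¹(j_*𝒯)`"), on the carriers of
`Surfaces/LatticePolarizedK3Fibration` (`LatticePolarizedK3Fibration π G`, the transcendental local
system `𝒯 ⊗ ℂ = ℒ^⊥`) and `Motives/LocalSystemParabolicCohomology` (`parabolicH1 = H¹(B, j_*𝕍)`).

## Sources (held texts `paper:arxiv-1701.03279` p0006–p0007, p0010; `paper:arxiv-0911.0277`
p0003, p0007–p0008; read 2026-08-15)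

* DHNT 2019, **Lemma 2.5**: "Let `π : 𝒳 → B` be a smooth threefold and suppose that the
  restriction `π^U : 𝒳^U → U` of `π` to a Zariski open set `U ⊂ B` is an `L`-polarized family of
  K3 surfaces, in the sense of Definition 2.1, where `L` is the Néron-Severi lattice of a general
  fibre of `𝒳^U`. Then we have an injective morphism of Hodge structures
  `H¹(U, j_*𝒯(𝒳^U) ⊗ ℂ) ↪ H³(𝒳, ℂ)`, the cokernel of which is supported in the `(1,2)` and
  `(2,1)` components. In particular, `h^{3,0}` of the Hodge structure on `H¹(U, j_*𝒯(𝒳^U))` is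
  equal to `h^{3,0}(𝒳)`." Proof, ibid.: "the Leray spectral sequence degenerates at the `E₂`
  level [Zucker]. Since the generic fibre of `π` is a K3 surface, we have `H²(B, R¹π_*ℂ) = 0`, so
  … `0 → H¹(B, R²π_*ℂ) → H³(𝒳, ℂ) → H⁰(B, R³π_*ℂ) → 0`. Now, [Zucker] gives a surjective map of
  sheaves `R²π_*ℂ → j_*R²π^U_*ℂ`, whose kernel is a skyscraper sheaf supported on `B ∖ U`. We thus
  have an isomorphism `H¹(B, R²π_*ℂ) ≅ H¹(B, j_*R²π^U_*ℂ)` and, by Equation (2.3), the latter group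
  is isomorphic to `H¹(U, j_*𝒯(𝒳_U) ⊗ ℂ), since … `𝒩𝒮(𝒳^U)` is a trivial local system"; and
  "`H⁰(B, R³π_*ℂ) ↪ ⊕ H³(S_i, ℂ)` … supported in the `(1,2)` and `(2,1)` components."
* DHNT 2019, eq. (2.4) = del Angel–Müller-Stach–van Straten–Zuo, Remark 6 / **Prop. 7**: "For a
  non-trivial, irreducible local system `𝕍` … `R(p) := Rank(𝕍) − dim(𝕍^{I(p)})` where `I(p)` is
  the local monodromy around the point `p`: `h¹(𝕍) = Σ_{p ∈ D} R(p) + (2g(S̄) − 2) Rank(𝕍)`"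
  (proof: `χ(j_*𝕍) = (2 − 2g) Rank(𝕍) − Σ R(p)`, `H²(j_*𝕍) = H²_c(S, 𝕍) = H⁰(S, 𝕍^*)^* = 0`).
* dAMSvSZ §0: "the space of cohomology classes of `X` that restrict to zero on fibres is …
  `Ker(H^{k+1}(X) → H⁰(S, R^{k+1}f_*ℂ_X)) = H¹(S, R^kf_*ℂ_X)`" and
  "`H¹(S̄, j_*R^kf_*ℂ_X) = H¹(S̄, R^k f̄_*ℂ_X̄) ⊂ H¹(S, R^kf_*ℂ_X)`".

## Rendering

* `fibreVanishingClasses π k = L¹Hᵏ(Y) := ⋂_b ker (Hᵏ(Y(ℂ); ℂ) → Hᵏ(X_b(ℂ); ℂ))` over ALL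
  complex points `b` of `B` (the kernel of the edge map to `H⁰(B, Rᵏπ_*ℂ) ↪ ∏_b Hᵏ(X_b)`, proper
  base change); for `k = 3` and K3 fibres over `U` only the singular fibres matter. By the quoted
  proof this IS the image of `H¹(B, R²π_*ℂ) ≅ H¹(B, j_*R²π^U_*ℂ) = H¹(B, j_*𝒯_ℂ) ⊕ H¹(B, ℂ)^{rank L}`
  — the printed identification with `H¹(U, j_*𝒯 ⊗ ℂ)` alone holds for `B ≅ ℙ¹` (`H¹(B, ℂ) = 0`),
  the case of every pencil of the route; so the named fact `DHNT2019_hodgeInjection` states: (a) for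
  `b₁(B(ℂ)) = 0`, a linear isomorphism `H¹(B, j_*𝒯_ℂ) = parabolicH1 (𝒯 ⊗ ℂ) ≃ L¹H³(Y)` exists (the
  injection with its image); (b) `L¹H³(Y)` is a sub-Hodge structure (spelled cone-free on a Hodge
  model, as the route's items do); (c) every `(3,0)`- and every `(0,3)`-class of `H³(Y)` lies in
  `L¹H³(Y)` ("cokernel supported in `(1,2)`, `(2,1)`", whence `h^{3,0}(L¹) = h^{3,0}(Y)`).
  Hypotheses: `LatticePolarizedK3Fibration` (smooth total space, Zariski-open `U`) and
  `HasGenericNS` ("`L` is the Néron–Severi lattice of a general fibre", which is what makes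
  `𝒯 ⊗ ℂ = ℒ^⊥`).
* `LocalSystem.localInvariantRank 𝕍 b = dim 𝕍^{I(b)}`: the largest rank of the flat sections of `𝕍`
  over `N ∩ U`, `N` a neighbourhood of `b` with `N ∩ U` connected (attained on punctured discs);
  `LocalSystem.IsIrreducible`. `DelAngelEtAl2010_finrank_parabolicH1` — Prop. 7 on a
  smooth projective curve `B` with `U` the complement of finitely many points, in `ℤ` and
  additively in `R(p)` (no truncated subtraction), `2g = b₁(B(ℂ))`.

NOT here: Zucker's Hodge structure on `H¹(B, j_*𝒯)` as an object (only its image `L¹H³`), the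
`L²`/Higgs complexes, DHNT Prop. 2.10–2.12.

## References

* [DoranHarderNovoseltsevThompson2019] DHNT, Math. Z. 294 (2019), Lemma 2.5, eq. (2.4).
* [DelAngelMullerStachVanStratenZuo2010] del Angel–Müller-Stach–van Straten–Zuo, Acta Math.
  Vietnam. 35 (2010), §0, Remark 6, Prop. 7.
* [Zucker1979] S. Zucker, Ann. of Math. 109 (1979) (degeneration of Leray over curves; `j_*𝕍`).
-/

noncomputable section

open CategoryTheory AlgebraicGeometry
open _root_.Topology _root_.Filter
open Literature.AlgebraicTopology.SingularHomology

universe u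

/-! ### Local invariants and irreducibility of local systems (general) -/

namespace Literature.AlgebraicGeometry.Motives.LocalSystem

variable {R : Type u} [Ring R]

/-- A local system is **irreducible** if every transport-stable family of submodules of its fibres
is `0` or everything (an irreducible monodromy representation, on a path-connected base).
[cite: DelAngelMullerStachVanStratenZuo2010, Remark 6] -/
def IsIrreducible {S : Type u} [TopologicalSpace S] (V : LocalSystem R S) : Prop :=
  ∀ W : ∀ s : S, Submodule R (V.fiber s),
    (∀ ⦃s t : S⦄ (γ : Path.Homotopic.Quotient s t), W s ≤ (W t).comap (V.transport γ)) →
      (∀ s, W s = ⊥) ∨ ∀ s, W s = ⊤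

variable {T : Type u} [TopologicalSpace T] {U : Set T}

/-- The restriction of a local system on `U ⊆ T` to `N ∩ U`, `N ⊆ T`. [cite: Deligne1970, I.1] -/
abbrev restrictTo (V : LocalSystem R U) (N : Set T) : LocalSystem R {s : U | s.1 ∈ N} :=
  V.comap ⟨Subtype.val, continuous_subtype_val⟩

/-- **The rank of the local invariants `dim 𝕍^{I(b)}` at `b ∈ T`** of a local system `𝕍` on
`U ⊆ T`: the largest rank of the space of flat sections of `𝕍` over `N ∩ U` for `N` a neighbourhood
of `b` in `T` with `N ∩ U` connected (on a Riemann surface with `b` a puncture of `U` this is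
attained on every punctured disc `Δ_b^*`, where the flat sections are the invariants of the local
monodromy `I(b)`; junk value `0` if no such `N` exists). [cite: DelAngelMullerStachVanStratenZuo2010, Remark 6] -/
def localInvariantRank (V : LocalSystem R U) (b : T) : ℕ :=
  ⨆ N : {N : Set T // N ∈ 𝓝 b ∧ IsConnected (N ∩ U)},
    Module.finrank R (V.restrictTo N.1).flatSections

end Literature.AlgebraicGeometry.Motives.LocalSystem

namespace Literature.AlgebraicGeometry.Surfaces

/-! ### The Leray subspace `L¹Hᵏ(Y)`: classes vanishing on every fibre -/

section Leray

variable {Y B : Motives.SchemeOver ℂ} (π : Y ⟶ B) (k : ℕ)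

/-- **`L¹Hᵏ(Y) ⊆ Hᵏ(Y(ℂ); ℂ)`, the classes restricting to zero on every fibre `X_b`, `b ∈ B(ℂ)`**
— the kernel of the edge map `Hᵏ(Y) → H⁰(B, Rᵏπ_*ℂ) (↪ ∏_b Hᵏ(X_b))` of the Leray spectral
sequence ("the space of cohomology classes of `X` that restrict to zero on fibres"); for a
K3-fibred threefold and `k = 3` it is the image of `H¹(B, R²π_*ℂ) ↪ H³(Y)` of DHNT's proof.
[cite: DelAngelMullerStachVanStratenZuo2010, §0] [cite: DoranHarderNovoseltsevThompson2019, Lemma 2.5 (proof)] -/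
def fibreVanishingClasses : Submodule ℂ (HodgeTheory.complexBetti Y k) :=
  ⨅ b : Motives.ComplexPoints B,
    LinearMap.ker (HodgeTheory.complexBetti.map (Motives.fiberι π b) k).hom

/-- Membership in `L¹Hᵏ(Y)`: vanishing of all fibre restrictions. [cite: DelAngelMullerStachVanStratenZuo2010, §0] -/
theorem mem_fibreVanishingClasses_iff (c : HodgeTheory.complexBetti Y k) :
    c ∈ fibreVanishingClasses π k ↔
      ∀ b : Motives.ComplexPoints B, HodgeTheory.complexBetti.map (Motives.fiberι π b) k c = 0 := by
  simp [fibreVanishingClasses, Submodule.mem_iInf]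

/-- `L¹` is functorial under restriction of global classes: the restriction of a class of `L¹Hᵏ(Y)`
to any fibre vanishes (unfolding, pointwise form). [cite: DelAngelMullerStachVanStratenZuo2010, §0] -/
theorem map_fiberι_eq_zero_of_mem {c : HodgeTheory.complexBetti Y k} (hc : c ∈ fibreVanishingClasses π k)
    (b : Motives.ComplexPoints B) : HodgeTheory.complexBetti.map (Motives.fiberι π b) k c = 0 :=
  (mem_fibreVanishingClasses_iff π k c).1 hc b

end Leray

/-! ### DHNT Lemma 2.5 (named fact) -/

/-- **DHNT 2019, Lemma 2.5: `H¹(B, j_*𝒯 ⊗ ℂ) ↪ H³(Y, ℂ)` with cokernel of types `(2,1)`, `(1,2)`.**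
"Let `π : 𝒳 → B` be a smooth threefold and suppose that the restriction `π^U` … to a Zariski open
set `U ⊂ B` is an `L`-polarized family of K3 surfaces … where `L` is the Néron-Severi lattice of a
general fibre of `𝒳^U`. Then we have an injective morphism of Hodge structures
`H¹(U, j_*𝒯(𝒳^U) ⊗ ℂ) ↪ H³(𝒳, ℂ)`, the cokernel of which is supported in the `(1,2)` and `(2,1)`
components. In particular, `h^{3,0}` of the Hodge structure on `H¹(U, j_*𝒯(𝒳^U))` is equal to
`h^{3,0}(𝒳)`." Rendering (module docstring), for `F : LatticePolarizedK3Fibration π G` with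
`HasGenericNS`, writing `L¹ = fibreVanishingClasses π 3` for the image (`= H¹(B, R²π_*ℂ)`, the
proof's Leray step): (a) if `b₁(B(ℂ)) = 0` (`B ≅ ℙ¹`, where the proof's
`H¹(B, R²π_*ℂ) ≅ H¹(U, j_*𝒯 ⊗ ℂ)` holds), there is a linear isomorphism
`parabolicH1 (𝒯 ⊗ ℂ) ≃ L¹`; (b) `L¹` is a sub-Hodge structure of `H³(Y)` (on every Hodge model,
cone-free spelling); (c) every class of type `(3,0)` or `(0,3)` lies in `L¹`.
[cite: DoranHarderNovoseltsevThompson2019, Lemma 2.5] [cite: Zucker1979, §15]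
[cite: DelAngelMullerStachVanStratenZuo2010, §0] -/
def DHNT2019_hodgeInjection : Prop :=
  ∀ ⦃Y B : Motives.SchemeOver ℂ⦄ (π : Y ⟶ B) ⦃ι : Type⦄ [Fintype ι] (G : Matrix ι ι ℤ)
    (F : LatticePolarizedK3Fibration π G), F.polarization.HasGenericNS →
    (Module.finrank ℂ (HodgeTheory.complexBetti B 1) = 0 →
      Nonempty (F.polarization.transcendentalLocalSystem.parabolicH1 ≃ₗ[ℂ]
        fibreVanishingClasses π 3)) ∧
    (∀ A : HodgeTheory.HodgeModel 3 Y,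
      (fibreVanishingClasses π 3).map (A.pullback 3).hom =
        ⨆ (p : ℕ) (q : ℕ) (_ : p + q = 3),
          (fibreVanishingClasses π 3).map (A.pullback 3).hom ⊓ A.hodgePQ 3 p q) ∧
    ∀ c : HodgeTheory.complexBetti Y 3,
      (HodgeTheory.IsOfHodgeType 3 Y 3 3 0 c ∨ HodgeTheory.IsOfHodgeType 3 Y 3 0 3 c) →
        c ∈ fibreVanishingClasses π 3

/-- Under the fact: `(3,0)`-classes of `H³(Y)` vanish on every fibre
("`h^{3,0}(H¹(U, j_*𝒯)) = h^{3,0}(𝒳)`": the `(3,0)`-part lies in the image).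
[cite: DoranHarderNovoseltsevThompson2019, Lemma 2.5] -/
theorem DHNT2019_hodgeInjection.mem_of_isOfHodgeType_three_zero (h : DHNT2019_hodgeInjection)
    {Y B : Motives.SchemeOver ℂ} {π : Y ⟶ B} {ι : Type} [Fintype ι] {G : Matrix ι ι ℤ}
    (F : LatticePolarizedK3Fibration π G) (hNS : F.polarization.HasGenericNS)
    {c : HodgeTheory.complexBetti Y 3} (hc : HodgeTheory.IsOfHodgeType 3 Y 3 3 0 c) :
    c ∈ fibreVanishingClasses π 3 :=
  (h π G F hNS).2.2 c (Or.inl hc)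

/-- Under the fact, over a base with `b₁ = 0` (e.g. `ℙ¹`): `h¹(B, j_*𝒯 ⊗ ℂ) = dim L¹H³(Y)`; in
particular `H³(Y) = H¹(ℙ¹, j_*𝒯)` exactly when `b₃(Y) = h¹(j_*𝒯)` (the route's "entirely
variable" `H³`). [cite: DoranHarderNovoseltsevThompson2019, Lemma 2.5] -/
theorem DHNT2019_hodgeInjection.finrank_parabolicH1_eq (h : DHNT2019_hodgeInjection)
    {Y B : Motives.SchemeOver ℂ} {π : Y ⟶ B} {ι : Type} [Fintype ι] {G : Matrix ι ι ℤ}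
    (F : LatticePolarizedK3Fibration π G) (hNS : F.polarization.HasGenericNS)
    (hB : Module.finrank ℂ (HodgeTheory.complexBetti B 1) = 0) :
    Module.finrank ℂ F.polarization.transcendentalLocalSystem.parabolicH1 =
      Module.finrank ℂ (fibreVanishingClasses π 3) := by
  obtain ⟨e⟩ := (h π G F hNS).1 hB
  exact e.finrank_eq

/-! ### The rank of `H¹(B, j_*𝕍)` (DHNT eq. (2.4); dAMSvSZ Prop. 7) -/

/-- **del Angel–Müller-Stach–van Straten–Zuo 2010, Prop. 7 (= DHNT 2019, eq. (2.4)): the rank of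
the parabolic cohomology.** "For a non-trivial, irreducible local system `𝕍` there is a simple
classical formula for the dimension `h¹(𝕍) := dim H¹(ℙ¹, j_*𝕍)` in terms of the ramification
indices `R(p) := Rank(𝕍) − dim(𝕍^{I(p)})`, where `I(p)` is the local monodromy around the point
`p`: Proposition 7. `h¹(𝕍) = Σ_{p ∈ D} R(p) + (2g(S̄) − 2) Rank(𝕍)`." Rendering: `S̄ = B(ℂ)` for a
smooth projective curve `B`, `U = B(ℂ) ∖ D` the complex points off a proper Zariski-closed subset,
`𝕍` a `ℂ`-local system on `U` with finite-dimensional fibres, non-trivial and irreducible; then, in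
`ℤ` and with `2g = b₁(B(ℂ))`,
`h¹ + Σ_{p ∈ D} dim 𝕍^{I(p)} = #D · Rank 𝕍 + (b₁ − 2) · Rank 𝕍` — i.e. the printed formula with
`R(p)` expanded (`localInvariantRank`; `∑ᶠ` over the finite set `D = Uᶜ`).
[cite: DelAngelMullerStachVanStratenZuo2010, Remark 6 and Proposition 7]
[cite: DoranHarderNovoseltsevThompson2019, eq. (2.4)] -/
def DelAngelEtAl2010_finrank_parabolicH1 : Prop :=
  ∀ (B : Motives.SchemeOver ℂ), Motives.IsSmoothProjective 1 B →
    ∀ (U : Set (Motives.ComplexPoints B)),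
      (∃ Z : Set B.left, IsClosed Z ∧ Z ≠ Set.univ ∧ U = {s | s.pt ∉ Z}) →
      ∀ (V : Motives.LocalSystem ℂ U) (s₀ : U), Module.Finite ℂ (V.fiber s₀) →
        ¬ V.IsTrivial → V.IsIrreducible →
          (Module.finrank ℂ V.parabolicH1 : ℤ) + ∑ᶠ b ∈ Uᶜ, (V.localInvariantRank b : ℤ) =
            ∑ᶠ b ∈ Uᶜ, (V.rank s₀ : ℤ) +
              ((Module.finrank ℂ (HodgeTheory.complexBetti B 1) : ℤ) - 2) * (V.rank s₀ : ℤ)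

end Literature.AlgebraicGeometry.Surfaces

end
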